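import Summits.CriticalPhenomena.Ising3DConformalLimit.Theses.PerfectScreening
import Literature.Probability.LatticeModels.LatticeGreenPoisson
import Literature.Probability.LatticeModels.CriticalTwoPointLawDimension
import Literature.Probability.LatticeModels.HighDimPointwiseTriviality
import Literature.Probability.LatticeModels.CriticalTwoPointLower
import HarnessLib

/-!
# Route `PerfectScreening`: the x-space infrared bound with constant (`ScreeningInfraredBound`)

Item `stmt-CriticalPhenomena-1347` of route `CriticalPhenomena/Ising3DConformalLimit/PerfectScreening`.
Write `G := criticalTwoPoint 3 = ⟨σ₀σ_x⟩⁺_{β_c(3)}` and `G₀ := latticeGreen / 2`, the Green function of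
the graph Laplacian of `ℤ³` (`(-Δ) G₀ = δ₀`, `latticeLaplacianZd_half_latticeGreen`; the route writes
`G₀` as the inline Brillouin-zone integral `(2(2π)³)⁻¹ ∫_{[-π,π]³} cos(p·x)/∑ᵢ(1 - cos pᵢ) dp`, which is
`latticeGreen x / 2` by `setIntegral_pi_cos_div_eq_half_latticeGreen`). We prove

  `SubH → ∀ x, G(x) ≤ 6 (1 - G(e₀)) · G₀(x)`,

where `SubH` (crux `SubharmonicOffOrigin`) says `Δ G ≥ 0` off the origin. Proof (maximum principle
at infinity): the point charge of `G` at the origin is `-Δ G (0) = 6 (1 - G(e₀)) =: μ₀` (lattice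
symmetries: all six neighbours of `0` carry the value `G(e₀)`, and `G(0) = 1`), so
`u := G - μ₀ G₀` has `Δ u = Δ G + μ₀ δ₀ ≥ 0` everywhere; `u → 0` at infinity
(`criticalTwoPoint_tendsto_zero_cofinite`, `tendsto_latticeGreen_cofinite`); hence `u ≤ 0`
(`IsZdSubharmonicOn.nonpos_of_tendsto_zero`).
-/

namespace Summit.CriticalPhenomena.Ising3DConformalLimit.Theorems

open Literature.Probability.LatticeModels Filter Topology

/-- **The charge of the critical two-point function at the origin**:
`Δ G (0) = -6 (1 - G(e₀))` for `G = ⟨σ₀σ_x⟩⁺_{β_c(3)}` on `ℤ³` — the six neighbours of the origin all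
carry the value `G(e₀)` (coordinate permutations and reflections of `ℤ³`,
`twoPointPlus_perm_invariant_holds`, `criticalTwoPoint_neg`) and `G(0) = 1`. [folklore] -/
theorem latticeLaplacianZd_criticalTwoPoint_zero :
    latticeLaplacianZd (criticalTwoPoint 3) 0 =
      -(6 * (1 - criticalTwoPoint 3 (Pi.single 0 1))) := by
  have h : ∀ i : Fin 3, criticalTwoPoint 3 ((0 : Site 3) + Pi.single i 1) +
      criticalTwoPoint 3 ((0 : Site 3) - Pi.single i 1) =
        2 * criticalTwoPoint 3 (Pi.single 0 1) := by
    intro i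
    rw [zero_add, zero_sub, criticalTwoPoint_neg]
    have hi : criticalTwoPoint 3 (Pi.single i 1) = criticalTwoPoint 3 (Pi.single 0 1) :=
      twoPointPlus_single_eq_single twoPointPlus_perm_invariant_holds (criticalBeta_nonneg 3) i 0 1
    rw [hi]
    ring
  rw [latticeLaplacianZd_three, criticalTwoPoint_zero', Finset.sum_congr rfl fun i _ => h i]
  simp only [Finset.sum_const, Finset.card_univ, Fintype.card_fin, nsmul_eq_mul]
  push_cast
  ring

/-- **`G ≤ μ₀ G₀` under SubH**, with `G₀ = latticeGreen / 2` and `μ₀ = 6 (1 - G(e₀))`: if the critical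
two-point function `G = ⟨σ₀σ_x⟩⁺_{β_c(3)}` is lattice-subharmonic off the origin, then
`G(x) ≤ 6 (1 - G(e₀)) · latticeGreen x / 2` for every `x ∈ ℤ³`. Maximum principle at infinity for
`u = G - μ₀ · latticeGreen / 2`, which is subharmonic on all of `ℤ³` (`Δ u = Δ G + μ₀ δ₀`, and
`Δ G (0) = -μ₀`) and tends to `0`. [folklore] -/
theorem criticalTwoPoint_le_mul_half_latticeGreen_of_subharmonic
    (hSubH : ∀ x : Site 3, x ≠ 0 → 6 * criticalTwoPoint 3 x ≤
      ∑ i : Fin 3, (criticalTwoPoint 3 (x + Pi.single i 1) + criticalTwoPoint 3 (x - Pi.single i 1)))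
    (x : Site 3) :
    criticalTwoPoint 3 x ≤ 6 * (1 - criticalTwoPoint 3 (Pi.single 0 1)) * (latticeGreen x / 2) := by
  -- the comparison function `u = G - μ₀ G₀`
  obtain ⟨μ₀, hμ₀⟩ : ∃ μ : ℝ, μ = 6 * (1 - criticalTwoPoint 3 (Pi.single 0 1)) := ⟨_, rfl⟩
  obtain ⟨u, hu⟩ : ∃ u : Site 3 → ℝ,
      u = criticalTwoPoint 3 - fun z => μ₀ * (latticeGreen z / 2) := ⟨_, rfl⟩
  -- its Laplacian: `Δ u = Δ G + μ₀ [· = 0]` (Poisson identity for `latticeGreen / 2`)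
  have hΔu : ∀ z, latticeLaplacianZd u z =
      latticeLaplacianZd (criticalTwoPoint 3) z + μ₀ * (if z = 0 then 1 else 0) := by
    intro z
    rw [hu, latticeLaplacianZd_sub, latticeLaplacianZd_const_mul,
      latticeLaplacianZd_half_latticeGreen 3 le_rfl z]
    ring
  -- `u` is subharmonic on all of `ℤ³`
  have hsub : IsZdSubharmonicOn u Set.univ := by
    intro z _
    rw [hΔu z]
    by_cases hz : z = 0
    · subst hz
      rw [if_pos rfl, latticeLaplacianZd_criticalTwoPoint_zero, hμ₀]
      simp only [mul_one, neg_add_cancel, le_refl]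
    · rw [if_neg hz, mul_zero, add_zero, latticeLaplacianZd_three, sub_nonneg]
      exact hSubH z hz
  -- `u → 0` at infinity
  have hlim : Tendsto u cofinite (𝓝 0) := by
    have h1 : Tendsto (criticalTwoPoint 3) cofinite (𝓝 0) := criticalTwoPoint_tendsto_zero_cofinite
    have h2 : Tendsto (fun z : Site 3 => μ₀ * (latticeGreen z / 2)) cofinite (𝓝 0) := by
      have h := ((tendsto_latticeGreen_cofinite 3 le_rfl).div_const 2).const_mul μ₀
      simpa using h
    have h := h1.sub h2
    rw [sub_zero] at h
    rw [hu]
    exact h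
  -- maximum principle at infinity
  have hux : u x ≤ 0 := hsub.nonpos_of_tendsto_zero (by norm_num) hlim x
  rw [hu, Pi.sub_apply, sub_nonpos, hμ₀] at hux
  exact hux

/-- **Item `ScreeningInfraredBound` (stmt-CriticalPhenomena-1347) of route `PerfectScreening`**: the
x-space infrared bound with constant, `SubH → ∀ x, G(x) ≤ 6 (1 - G(e₀)) · G₀(x)` with
`G = ⟨σ₀σ_x⟩⁺_{β_c(3)}` and `G₀(x) = (2(2π)³)⁻¹ ∫_{[-π,π]³} cos(p·x)/∑ᵢ(1 - cos pᵢ) dp` the Green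
function of the graph Laplacian of `ℤ³` (`= latticeGreen x / 2`). [folklore] -/
theorem screeningInfraredBound_proof :
    Summit.CriticalPhenomena.Ising3DConformalLimit.Theses.PerfectScreening.ScreeningInfraredBound := by
  unfold Summit.CriticalPhenomena.Ising3DConformalLimit.Theses.PerfectScreening.ScreeningInfraredBound
  intro hSubH x
  rw [setIntegral_pi_cos_div_eq_half_latticeGreen x]
  exact criticalTwoPoint_le_mul_half_latticeGreen_of_subharmonic hSubH x

end Summit.CriticalPhenomena.Ising3DConformalLimit.Theorems
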